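import Mathlib

/-!
# Crux `MonotoneSuffices` (stmt-PneNP-18026), line `Sketch` — scope of the SHIFT lever, part 2:
# the collision lower bound for a law on shifts

For a finitely supported law on shift sets (weights `w i ≥ 0`, `∑ w i = 1`, sets `Rf i`) the
COLLISION NUMBER is `Coll = ∑_{i,j} w i · w j · 2^{#(Rf i ∩ Rf j)}`; it is the second moment
`E_μ[(dν/dμ)²]` of the density of the up-shifted uniform law `ν = law(x ∨ 1_R)` (evidence memo
`session4-shift-levers.md` §0), so a shift lever with bounded density distortion needs bounded `Coll`.
Against a set `F` of relevant coordinates: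

* `sum_sum_card_inter_eq_sum_sq` — `∑_{i,j} w i w j #(Rf i ∩ Rf j ∩ F) = ∑_{e ∈ F} q_e²`,
  `q_e = ∑_i w i [e ∈ Rf i]` (the coverage profile), and `∑_e q_e = ∑_i w i #(Rf i ∩ F)`;
* `sq_sum_div_card_le` — Cauchy–Schwarz: `(∑_i w i #(Rf i ∩ F))² / #F ≤ ∑_{e ∈ F} q_e²`;
* `exp_le_collision` / **`shift_collision`** — Jensen for `exp`:
  `2^{(∑_i w i #(Rf i ∩ F))² / #F} ≤ Coll`.

So a law whose shifts meet `F` in `m` coordinates on average has `Coll ≥ 2^{m²/#F}`: together with part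
1 (entering a coin of restricted influence `I⁺` needs `m ≥ 1/(2 I⁺)`) this is the shift-resistance
theorem of the memo (§2).
-/

set_option linter.dupNamespace false -- `Summit.PneNP.PneNP.…`: summit = sub-problem name (D-0017 single-conjunct layout)

namespace Summit.PneNP.PneNP.Theorems.MonotoneSuffices.ShiftNoGo

open Finset Real

variable {ι α : Type*} [DecidableEq α]

/-! ### The coverage profile -/

/-- `#(R ∩ F) = ∑_{e ∈ F} [e ∈ R]`. [folklore] -/
theorem card_inter_eq_sum_ite (R F : Finset α) :
    (#(R ∩ F) : ℝ) = ∑ e ∈ F, if e ∈ R then (1 : ℝ) else 0 := by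
  rw [sum_boole, filter_mem_eq_inter, inter_comm]

/-- `#(R ∩ R' ∩ F) = ∑_{e ∈ F} [e ∈ R] · [e ∈ R']`. [folklore] -/
theorem card_inter_inter_eq_sum (R R' F : Finset α) :
    (#(R ∩ R' ∩ F) : ℝ) = ∑ e ∈ F, (if e ∈ R then (1 : ℝ) else 0) * (if e ∈ R' then (1 : ℝ) else 0) := by
  rw [card_inter_eq_sum_ite]
  refine sum_congr rfl fun e _ => ?_
  by_cases h1 : e ∈ R <;> by_cases h2 : e ∈ R' <;> simp [h1, h2, mem_inter]

/-- **The double sum of triple intersections is the squared coverage profile**: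
`∑_{i,j} w i w j #(Rf i ∩ Rf j ∩ F) = ∑_{e ∈ F} (∑_i w i [e ∈ Rf i])²`. [folklore] -/
theorem sum_sum_card_inter_eq_sum_sq (s : Finset ι) (w : ι → ℝ) (Rf : ι → Finset α) (F : Finset α) :
    ∑ i ∈ s, ∑ j ∈ s, w i * w j * (#(Rf i ∩ Rf j ∩ F) : ℝ) =
      ∑ e ∈ F, (∑ i ∈ s, w i * if e ∈ Rf i then (1 : ℝ) else 0) ^ 2 := by
  symm
  calc ∑ e ∈ F, (∑ i ∈ s, w i * if e ∈ Rf i then (1 : ℝ) else 0) ^ 2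
      = ∑ e ∈ F, ∑ i ∈ s, ∑ j ∈ s,
          (w i * if e ∈ Rf i then (1 : ℝ) else 0) * (w j * if e ∈ Rf j then (1 : ℝ) else 0) :=
        sum_congr rfl fun e _ => by rw [sq, sum_mul_sum]
    _ = ∑ i ∈ s, ∑ e ∈ F, ∑ j ∈ s,
          (w i * if e ∈ Rf i then (1 : ℝ) else 0) * (w j * if e ∈ Rf j then (1 : ℝ) else 0) := sum_comm
    _ = ∑ i ∈ s, ∑ j ∈ s, ∑ e ∈ F,
          (w i * if e ∈ Rf i then (1 : ℝ) else 0) * (w j * if e ∈ Rf j then (1 : ℝ) else 0) :=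
        sum_congr rfl fun i _ => sum_comm
    _ = ∑ i ∈ s, ∑ j ∈ s, w i * w j * (#(Rf i ∩ Rf j ∩ F) : ℝ) := by
        refine sum_congr rfl fun i _ => sum_congr rfl fun j _ => ?_
        rw [card_inter_inter_eq_sum, mul_sum]
        refine sum_congr rfl fun e _ => ?_
        ring

/-- The total coverage: `∑_{e ∈ F} ∑_i w i [e ∈ Rf i] = ∑_i w i #(Rf i ∩ F)`. [folklore] -/
theorem sum_coverage_eq (s : Finset ι) (w : ι → ℝ) (Rf : ι → Finset α) (F : Finset α) :
    ∑ e ∈ F, (∑ i ∈ s, w i * if e ∈ Rf i then (1 : ℝ) else 0) = ∑ i ∈ s, w i * (#(Rf i ∩ F) : ℝ) := by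
  rw [sum_comm]
  refine sum_congr rfl fun i _ => ?_
  rw [card_inter_eq_sum_ite, mul_sum]

/-- **Cauchy–Schwarz for the coverage profile**:
`(∑_i w i #(Rf i ∩ F))² / #F ≤ ∑_{e ∈ F} (∑_i w i [e ∈ Rf i])²`. [folklore] -/
theorem sq_sum_div_card_le (s : Finset ι) (w : ι → ℝ) (Rf : ι → Finset α) (F : Finset α) :
    (∑ i ∈ s, w i * (#(Rf i ∩ F) : ℝ)) ^ 2 / (#F : ℝ) ≤
      ∑ e ∈ F, (∑ i ∈ s, w i * if e ∈ Rf i then (1 : ℝ) else 0) ^ 2 := by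
  rw [← sum_coverage_eq]
  rcases Nat.eq_zero_or_pos #F with hF | hF
  · rw [hF, Nat.cast_zero, div_zero]
    exact sum_nonneg fun e _ => sq_nonneg _
  · rw [div_le_iff₀ (by exact_mod_cast hF), mul_comm]
    exact sq_sum_le_card_mul_sum_sq

/-! ### Jensen -/

/-- `exp (log 2 · m) = 2^m` for natural `m`. [folklore] -/
theorem exp_log_two_mul_nat (m : ℕ) : Real.exp (Real.log 2 * m) = (2 : ℝ) ^ m := by
  rw [mul_comm, Real.exp_nat_mul, Real.exp_log two_pos]

/-- **Jensen step**: `exp (log 2 · ∑_{i,j} w i w j a i j) ≤ ∑_{i,j} w i w j exp (log 2 · a i j)` for a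
probability vector `w`. [folklore] -/
theorem exp_sum_sum_le (s : Finset ι) (w : ι → ℝ) (hw0 : ∀ i ∈ s, 0 ≤ w i) (hw1 : ∑ i ∈ s, w i = 1)
    (a : ι → ι → ℝ) :
    Real.exp (Real.log 2 * ∑ i ∈ s, ∑ j ∈ s, w i * w j * a i j) ≤
      ∑ i ∈ s, ∑ j ∈ s, w i * w j * Real.exp (Real.log 2 * a i j) := by
  have h := convexOn_exp.map_sum_le (t := s ×ˢ s) (w := fun p => w p.1 * w p.2)
    (p := fun p => Real.log 2 * a p.1 p.2)
    (fun p hp => mul_nonneg (hw0 p.1 (mem_product.1 hp).1) (hw0 p.2 (mem_product.1 hp).2))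
    (by rw [sum_product, ← sum_mul_sum, hw1, mul_one]) (fun p _ => Set.mem_univ _)
  simp only [smul_eq_mul, sum_product] at h
  have e1 : ∑ x ∈ s, ∑ y ∈ s, w x * w y * (Real.log 2 * a x y) =
      Real.log 2 * ∑ i ∈ s, ∑ j ∈ s, w i * w j * a i j := by
    rw [mul_sum]
    refine sum_congr rfl fun i _ => ?_
    rw [mul_sum]
    refine sum_congr rfl fun j _ => ?_
    ring
  rw [e1] at h
  exact h

/-- **The collision lower bound (exponential form)**:
`exp (log 2 · (∑_i w i #(Rf i ∩ F))² / #F) ≤ ∑_{i,j} w i w j 2^{#(Rf i ∩ Rf j)}`. [folklore] -/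
theorem exp_le_collision (s : Finset ι) (w : ι → ℝ) (hw0 : ∀ i ∈ s, 0 ≤ w i) (hw1 : ∑ i ∈ s, w i = 1)
    (Rf : ι → Finset α) (F : Finset α) :
    Real.exp (Real.log 2 * ((∑ i ∈ s, w i * (#(Rf i ∩ F) : ℝ)) ^ 2 / (#F : ℝ))) ≤
      ∑ i ∈ s, ∑ j ∈ s, w i * w j * (2 : ℝ) ^ #(Rf i ∩ Rf j) := by
  have hlog : 0 < Real.log 2 := Real.log_pos one_lt_two
  calc Real.exp (Real.log 2 * ((∑ i ∈ s, w i * (#(Rf i ∩ F) : ℝ)) ^ 2 / (#F : ℝ)))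
      ≤ Real.exp (Real.log 2 * ∑ i ∈ s, ∑ j ∈ s, w i * w j * (#(Rf i ∩ Rf j ∩ F) : ℝ)) := by
        rw [Real.exp_le_exp, sum_sum_card_inter_eq_sum_sq]
        exact mul_le_mul_of_nonneg_left (sq_sum_div_card_le s w Rf F) hlog.le
    _ ≤ ∑ i ∈ s, ∑ j ∈ s, w i * w j * Real.exp (Real.log 2 * (#(Rf i ∩ Rf j ∩ F) : ℝ)) :=
        exp_sum_sum_le s w hw0 hw1 _
    _ ≤ ∑ i ∈ s, ∑ j ∈ s, w i * w j * (2 : ℝ) ^ #(Rf i ∩ Rf j) := by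
        refine sum_le_sum fun i hi => sum_le_sum fun j hj => ?_
        refine mul_le_mul_of_nonneg_left ?_ (mul_nonneg (hw0 i hi) (hw0 j hj))
        rw [exp_log_two_mul_nat]
        exact pow_le_pow_right₀ one_le_two (card_le_card inter_subset_left)

/-- **shift_collision** (registered helper sub-goal of stmt-PneNP-18026, scope of the shift lever, part 2):
a law on shifts meeting `F` in `m = ∑ w i #(Rf i ∩ F)` coordinates on average has collision number
`∑_{i,j} w i w j 2^{#(Rf i ∩ Rf j)} ≥ 2^{m²/#F}`. [folklore] -/
theorem shift_collision :
    ∀ {ι α : Type*} [DecidableEq α] (s : Finset ι) (w : ι → ℝ), (∀ i ∈ s, 0 ≤ w i) → ∑ i ∈ s, w i = 1 → ∀ (Rf : ι → Finset α) (F : Finset α), (2 : ℝ) ^ ((∑ i ∈ s, w i * (#(Rf i ∩ F) : ℝ)) ^ 2 / (#F : ℝ)) ≤ ∑ i ∈ s, ∑ j ∈ s, w i * w j * (2 : ℝ) ^ #(Rf i ∩ Rf j) := by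
  intro ι α _ s w hw0 hw1 Rf F
  rw [Real.rpow_def_of_pos two_pos]
  exact exp_le_collision s w hw0 hw1 Rf F

end Summit.PneNP.PneNP.Theorems.MonotoneSuffices.ShiftNoGo
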